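import Mathlib
import HarnessLib
import Summits.Ventures.LatticeQCDFlow.Exactness.CompactHaar
import Summits.Ventures.LatticeQCDFlow.Exactness.EquivariantJacobianGaugeInvariance
import Summits.Ventures.LatticeQCDFlow.Exactness.SpectralCouplingLayerEquiv
import Summits.Ventures.LatticeQCDFlow.Exactness.SpectralKernelContinuity

/-!
# Exact Jacobians of conjugation-equivariant kernels are CLASS FUNCTIONS on the group — and so are those of Boyda's `SU(N)` spectral kernel

HONEST FRAMING: exact (Metropolis-corrected) sampling algorithms for lattice gauge theory;
figures of merit are autocorrelation/cost numbers at stated couplings and volumes; no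
continuum-physics claim.

Venture `LatticeQCDFlow` (cell pub-lqcd), topic `Exactness`; FANOUT row 10 (`eng-equiv`, engine
`latflow.equiv` `spectral.spectral_kernel`: a single-matrix kernel `h : SU(N) → SU(N)` that is
conjugation-equivariant BY DESIGN, `h(X P X⁻¹) = X h(P) X⁻¹`, with a booked log-det that is a
symmetric function of the spectrum; unit test "kernel log-det conjugation invariance"; Boyda et al.,
PRD 103 (2021) 074504 §III, named only).  NEW WORK of the cell at KERNEL level (one group element, no
lattice), complementing the layer-level class-function files: over `CompactHaar` (the Haar probability of
a compact group is a bi-invariant Haar measure), `EquivariantJacobianGaugeInvariance` (an exact Jacobian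
is a.e. invariant under every measure-preserving symmetry commuting with the map; everywhere if
continuous), and the tree's spectral-kernel structure (`spectralKernel_specialUnitaryGroup_conj`,
`…_bijective`, `continuous_spectralKernel_specialUnitaryGroup`).  Nothing is cited as a fact; no number;
no definition.

* `measurePreserving_conj_haarProbability` — conjugation `U ↦ g U g⁻¹` preserves the Haar probability
  of a compact group;
* **`HasJacobian.jac_conj_ae_eq`** — for a conjugation-equivariant measurable automorphism `Φ` of a
  compact group and ANY exact Jacobian `J` (`HasJacobian Haar Φ J`): `J(g U g⁻¹) = J(U)` for a.e. `U`,
  every `g`; **`HasJacobian.jac_conj_eq`** — everywhere, for a continuous real Jacobian `j ≥ 0`;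
* `exists_measurableEquiv_spectralKernel_sun` — Boyda's `SU(N)` spectral kernel with an invertible
  eigenvalue map (two-sided inverse realised by a kernel, `f` continuous on the unimodular torus) is
  `⇑Φ` for a measurable automorphism `Φ` of `SU(N)`;
* **`ae_conjInvariant_jacobian_spectralKernel_sun`**, **`conjInvariant_jacobian_spectralKernel_sun`** —
  hence EVERY exact Jacobian of that kernel for the Haar probability is a class function on `SU(N)`
  (a.e.; everywhere if continuous) — whatever density is certified exact, booked or not.
-/

noncomputable section

namespace Summit.Ventures.LatticeQCDFlow.Exactness

open MeasureTheory Matrix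
open Literature.LinearAlgebra.Matrix
open Literature.MathematicalPhysics.QuantumFieldTheory
open scoped ENNReal

/-! ## Any compact group -/

section General

variable {G : Type*} [Group G] [TopologicalSpace G] [IsTopologicalGroup G] [CompactSpace G]
  [MeasurableSpace G] [BorelSpace G]

/-- **Conjugation preserves the Haar probability of a compact group** (left invariance and, by
unimodularity of compact groups, right invariance). -/
theorem measurePreserving_conj_haarProbability (g : G) :
    MeasurePreserving (fun U : G => g * U * g⁻¹) (haarProbability G) (haarProbability G) :=
  (measurePreserving_mul_right (haarProbability G) g⁻¹).comp (measurePreserving_mul_left (haarProbability G) g)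

/-- **An exact Jacobian of a conjugation-equivariant automorphism is a class function almost
everywhere**: `Φ(g U g⁻¹) = g Φ(U) g⁻¹` for all `g, U` and `HasJacobian Haar Φ J` give
`J(g U g⁻¹) = J(U)` for Haar-a.e. `U`, every `g`. -/
theorem HasJacobian.jac_conj_ae_eq {Φ : G ≃ᵐ G} (hΦ : ∀ g U : G, Φ (g * U * g⁻¹) = g * Φ U * g⁻¹)
    {J : G → ℝ≥0∞} (h : HasJacobian (haarProbability G) Φ J) (g : G) :
    ∀ᵐ U ∂(haarProbability G), J (g * U * g⁻¹) = J U := by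
  set T : G ≃ᵐ G := (MeasurableEquiv.mulLeft g).trans (MeasurableEquiv.mulRight g⁻¹) with hT
  have hTco : ∀ U, T U = g * U * g⁻¹ := fun U => rfl
  have hTp : MeasurePreserving T (haarProbability G) (haarProbability G) := by
    have hfun : (T : G → G) = fun U => g * U * g⁻¹ := funext hTco
    rw [hfun]
    exact measurePreserving_conj_haarProbability g
  have hcomm : ∀ x, Φ (T x) = T (Φ x) := fun x => by rw [hTco, hTco]; exact hΦ g x
  have hae := h.jac_comp_symm_ae_eq T hTp hcomm
  filter_upwards [hae] with U hU
  rw [Function.comp_apply, hTco] at hU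
  exact hU

/-- **… and EVERYWHERE for a continuous Jacobian**: a continuous `j ≥ 0` with
`HasJacobian Haar Φ (ofReal ∘ j)` is a class function on `G`. -/
theorem HasJacobian.jac_conj_eq {Φ : G ≃ᵐ G} (hΦ : ∀ g U : G, Φ (g * U * g⁻¹) = g * Φ U * g⁻¹)
    {j : G → ℝ} (hj : Continuous j) (hj0 : ∀ U, 0 ≤ j U)
    (h : HasJacobian (haarProbability G) Φ (fun U => ENNReal.ofReal (j U))) (g U : G) :
    j (g * U * g⁻¹) = j U := by
  haveI : (haarProbability G).IsOpenPosMeasure := by unfold haarProbability; infer_instance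
  set T : G ≃ᵐ G := (MeasurableEquiv.mulLeft g).trans (MeasurableEquiv.mulRight g⁻¹) with hT
  have hTco : ∀ U, T U = g * U * g⁻¹ := fun U => rfl
  have hfun : (T : G → G) = fun U => g * U * g⁻¹ := funext hTco
  have hTp : MeasurePreserving T (haarProbability G) (haarProbability G) := by
    rw [hfun]
    exact measurePreserving_conj_haarProbability g
  have hTc : Continuous T := by
    rw [hfun]
    exact (continuous_const.mul continuous_id).mul continuous_const
  have hcomm : ∀ x, Φ (T x) = T (Φ x) := fun x => by rw [hTco, hTco]; exact hΦ g x
  have h1 := HasJacobian.jac_comp_symm_eq hj h T hTp hTc hcomm U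
  rw [hTco] at h1
  exact (ENNReal.ofReal_eq_ofReal_iff (hj0 _) (hj0 _)).1 h1

end General

/-! ## Boyda's `SU(N)` spectral kernel -/

section Spectral

variable {n : Type*} [Fintype n] [DecidableEq n]
  {f g : (n → ℂ) → (n → ℂ)} {h h' : Matrix.specialUnitaryGroup n ℂ → Matrix.specialUnitaryGroup n ℂ}
  (hf : ContinuousOn f {d | ∀ i, ‖d i‖ = 1})
  (hagree : ∀ (P : Matrix.specialUnitaryGroup n ℂ) (V : Matrix n n ℂ) (d : n → ℂ),
    V ∈ Matrix.unitaryGroup n ℂ → (P : Matrix n n ℂ) = V * diagonal d * star V →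
      ((h P : Matrix.specialUnitaryGroup n ℂ) : Matrix n n ℂ) = V * diagonal (f d) * star V)
  (hagree' : ∀ (P : Matrix.specialUnitaryGroup n ℂ) (V : Matrix n n ℂ) (d : n → ℂ),
    V ∈ Matrix.unitaryGroup n ℂ → (P : Matrix n n ℂ) = V * diagonal d * star V →
      ((h' P : Matrix.specialUnitaryGroup n ℂ) : Matrix n n ℂ) = V * diagonal (g d) * star V)
  (hgf : ∀ d : n → ℂ, (∀ i, ‖d i‖ = 1) → ∏ i, d i = 1 → g (f d) = d)
  (hfg : ∀ d : n → ℂ, (∀ i, ‖d i‖ = 1) → ∏ i, d i = 1 → f (g d) = d)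

include hf hagree hagree' hgf hfg

/-- **Boyda's `SU(N)` spectral kernel with an invertible eigenvalue map is a measurable automorphism
of `SU(N)`** (continuous bijection of a compact Hausdorff space). -/
theorem exists_measurableEquiv_spectralKernel_sun :
    ∃ Φ : Matrix.specialUnitaryGroup n ℂ ≃ᵐ Matrix.specialUnitaryGroup n ℂ, ⇑Φ = h := by
  haveI : SecondCountableTopology (Matrix n n ℂ) := inferInstanceAs (SecondCountableTopology (n → n → ℂ))
  haveI : SecondCountableTopology (Matrix.specialUnitaryGroup n ℂ) :=
    Topology.IsEmbedding.subtypeVal.secondCountableTopology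
  have hbij : Function.Bijective h := spectralKernel_specialUnitaryGroup_bijective hagree hagree' hgf hfg
  have hc : Continuous (Equiv.ofBijective h hbij) := continuous_spectralKernel_specialUnitaryGroup hf hagree
  exact ⟨(hc.homeoOfEquivCompactToT2).toMeasurableEquiv, rfl⟩

/-- **Every exact Jacobian of Boyda's `SU(N)` spectral kernel is a class function almost everywhere.** -/
theorem ae_conjInvariant_jacobian_spectralKernel_sun {J : Matrix.specialUnitaryGroup n ℂ → ℝ≥0∞}
    (hJ : HasJacobian (haarProbability (Matrix.specialUnitaryGroup n ℂ)) h J)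
    (X : Matrix.specialUnitaryGroup n ℂ) :
    ∀ᵐ P ∂(haarProbability (Matrix.specialUnitaryGroup n ℂ)), J (X * P * X⁻¹) = J P := by
  obtain ⟨Φ, hΦ⟩ := exists_measurableEquiv_spectralKernel_sun hf hagree hagree' hgf hfg
  have hconj : ∀ Y P : Matrix.specialUnitaryGroup n ℂ, Φ (Y * P * Y⁻¹) = Y * Φ P * Y⁻¹ := by
    intro Y P
    rw [hΦ]
    exact spectralKernel_specialUnitaryGroup_conj hagree Y P
  rw [← hΦ] at hJ
  exact HasJacobian.jac_conj_ae_eq hconj hJ X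

/-- **… and everywhere, for a continuous exact Jacobian `j ≥ 0`.** -/
theorem conjInvariant_jacobian_spectralKernel_sun {j : Matrix.specialUnitaryGroup n ℂ → ℝ}
    (hj : Continuous j) (hj0 : ∀ P, 0 ≤ j P)
    (hJ : HasJacobian (haarProbability (Matrix.specialUnitaryGroup n ℂ)) h (fun P => ENNReal.ofReal (j P)))
    (X P : Matrix.specialUnitaryGroup n ℂ) : j (X * P * X⁻¹) = j P := by
  obtain ⟨Φ, hΦ⟩ := exists_measurableEquiv_spectralKernel_sun hf hagree hagree' hgf hfg
  have hconj : ∀ Y P : Matrix.specialUnitaryGroup n ℂ, Φ (Y * P * Y⁻¹) = Y * Φ P * Y⁻¹ := by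
    intro Y P
    rw [hΦ]
    exact spectralKernel_specialUnitaryGroup_conj hagree Y P
  rw [← hΦ] at hJ
  exact HasJacobian.jac_conj_eq hconj hj hj0 hJ X P

end Spectral

end Summit.Ventures.LatticeQCDFlow.Exactness

end
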